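import Literature.AlgebraicGeometry.HodgeTheory.InvariantClassesFromTotalSpace
import Summits.HodgeConjecture.HodgeConjecture.Theorems.Ring2HypothesesFlatSectionsBaseReduction
import HarnessLib
import Literature.AlgebraicGeometry.HodgeTheory.InvariantClassesFromTotalSpaceProper

/-!
# Ring 2 — hypotheses layer: `VHC ⟹ FlatSectionsAlgebraic` over ALL smooth irreducible bases, modulo Deligne's partie fixe for PROPER smooth morphisms (Hodge II, Thm. 4.1.1 (i))

HONEST FRAMING: research route conditional on HC_CM; not a corollary; Q11.4-sentence-2 already refuted in dim ≥ 3.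

Cell `pub-hodge-ring2`, binder-prover seat `ring2-b01`, BINDER-OWNERS row b04/residual (LEAD L38.4 (b),
SKELETON-ACK v2 mint[0]). `HC_CM` (`Theses.RankFourFaces.CMAbelianHodge`) does not occur in this file; nothing here
proves a case of the Hodge conjecture. Module 2/2 of the seat; module 1 is
`Ring2HypothesesFlatSectionsBaseReduction` (fact-free: the flat-section node reduces to affine bases, and `VHC` gives
it for quasi-projective total spaces over any smooth irreducible base).

## What this part adds

The row-b04 task as minted reads `(hGIC : HodgeTheory.deligne_globalInvariantCycles) (h : VHC) : FlatSectionsAlgebraic`.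
The named fact `deligne_globalInvariantCycles` (`HodgeTheory/GlobalInvariantCycles`) quantifies over an open immersion
`i : 𝒳 ⟶ X̄` into a PROJECTIVE `X̄` and a quasi-projective base — so it speaks only about families whose total space is
quasi-projective, where module 1 needs no fact at all (`flatSection_algebraic_of_vhc_of_isQuasiProjectiveOver`, through
the tree THEOREM `deligne1968_invariantClass_fromTotalSpace_holds`). The families of `FlatSectionsAlgebraic` / `VHC`
(`Motives.IsSmoothProjectiveFamily`: smooth, PROPER, smooth projective fibres) whose total space is NOT quasi-projective
over an affine open of the base (Atiyah-flop families, `AnchorTransportVariationalHodgeQuasiProjective`) need the partie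
fixe for PROPER smooth morphisms — Deligne, Hodge II, Thm. 4.1.1 (i): for `S` smooth separated of finite type over `ℂ`
and `f : X → S` proper and smooth the Leray spectral sequence degenerates, so `Hᵏ(X; ℚ) → Γ(S, Rᵏf_*ℚ)` is onto. That
printed theorem is typed here as the NAMED FACT `deligne1971_invariantClass_fromTotalSpace_proper` — the sentence of
the tree's `deligne1968_invariantClass_fromTotalSpace` without its clause `IsQuasiProjectiveOver 𝒳` — and consumed as
a HYPOTHESIS `hD` (never as known):

* `deligne1968_invariantClass_fromTotalSpace_of_deligne1971` — consistency: the new fact implies the 1968 one;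
* `exists_globalSection_eq_of_flatSection_of_deligne1971` — over a smooth irreducible quasi-projective base a flat
  section of ANY smooth projective family is the section of one global class (fact at one point + identity principle);
* `flatSection_algebraic_of_deligne1971_of_vhc_of_isQuasiProjectiveOver_base` — hence `VHC` transports algebraicity of
  flat sections over quasi-projective bases, total space arbitrary;
* **`flatSectionsAlgebraic_of_deligne1971_of_vhc : deligne1971_… → VHC → FlatSectionsAlgebraic`** (all smooth
  irreducible bases, by module 1's `flatSectionsAlgebraic_of_affine`) and
  **`flatSectionsAlgebraic_iff_vhc_of_deligne1971 : deligne1971_… → (FlatSectionsAlgebraic ↔ VHC)`** — modulo this ONE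
  printed theorem the two typed forms of Conj. 11.3.1 are one node; row b04 then reads «≡ b03 modulo Hodge II 4.1.1 (i)».

References: [DeligneHodgeII1971] P. Deligne, Théorie de Hodge II, Publ. Math. IHÉS 40 (1971), Thm. 4.1.1, §3.2;
[CharlesSchnell2014Notes] Conj. 11.3.1, Thm. 11.3.4, Prop. 11.3.5; [VoisinHodgeII2003] Thm. 4.18, Lemma 4.17;
[Grothendieck1966] footnote 13.
-/

-- every declaration of this problem lives in `Summit.HodgeConjecture.HodgeConjecture.…` (summit = sub-problem)
set_option linter.dupNamespace false

noncomputable section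

open CategoryTheory AlgebraicGeometry Topology Filter
open Literature.AlgebraicGeometry Literature.AlgebraicGeometry.Motives Literature.AlgebraicGeometry.HodgeTheory

namespace Summit.HodgeConjecture.HodgeConjecture.Ring2.Hypotheses

/-! ## The proper-smooth partie fixe (Deligne, Hodge II, Thm. 4.1.1 (i)) — NAMED FACT, filed to Literature by the gate -/

/-- Consistency: the proper-smooth partie fixe implies the tree's projective one (`deligne1968_invariantClass_fromTotalSpace`,
Voisin II Thm. 4.18) — drop the quasi-projectivity of `𝒳`. [cite: DeligneHodgeII1971, Théorème 4.1.1 (i)]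
[cite: VoisinHodgeII2003, Thm. 4.18] -/
theorem deligne1968_invariantClass_fromTotalSpace_of_deligne1971 (hD : Literature.AlgebraicGeometry.HodgeTheory.deligne1971_invariantClass_fromTotalSpace_proper) :
    deligne1968_invariantClass_fromTotalSpace :=
  fun 𝒳 S f n hf _ hS hsm k σ hσ hpt s₀ => hD 𝒳 S f n hf hS hsm k σ hσ hpt s₀

/-! ## `VHC ⟹ FlatSectionsAlgebraic` modulo the proper-smooth partie fixe -/

/-- **A flat section over a smooth quasi-projective irreducible base is the section of ONE global class**, granted the
proper-smooth partie fixe (part XXVII's `exists_globalSection_eq_of_flatSection` with the fact in place of Deligne 1968: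
the fact at one point, then the identity principle `Theorems.HeckePrymWeilLine.gcs_section_eq_of_eq` for continuous
sections of the local system `Rᵏf_*ℂ` over the connected manifold `S(ℂ)` — Ehresmann,
`isCohomologicallyLocallyTrivialOn_univ_of_isSmoothProjectiveFamily`). [cite: DeligneHodgeII1971, Théorème 4.1.1 (i)]
[cite: VoisinHodgeII2003, Lemma 4.17] -/
theorem exists_globalSection_eq_of_flatSection_of_deligne1971
    (hD : Literature.AlgebraicGeometry.HodgeTheory.deligne1971_invariantClass_fromTotalSpace_proper) {n : ℕ} {𝒳 S : SchemeOver ℂ} (f : 𝒳 ⟶ S)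
    (hf : IsSmoothProjectiveFamily f n) (hS : IsQuasiProjectiveOver S)
    (hirr : IrreducibleSpace S.left) (hsm : AlgebraicGeometry.Smooth S.hom) (k : ℕ)
    {σ : ComplexPoints S → FiberClass f k} (hσ : Continuous σ) (hpt : ∀ s, (σ s).pt = s) :
    ∃ β : complexBetti 𝒳 k, ∀ s, σ s = globalSection f k β s := by
  haveI := hsm
  haveI := hirr
  haveI : LocallyOfFiniteType S.hom := hS.locallyOfFiniteType
  haveI : ConnectedSpace (ComplexPoints S) := (ComplexPoints.connectedSpace_iff_holds S).2 inferInstance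
  obtain ⟨d, hd⟩ := exists_smoothOfRelativeDimension_of_connectedSpace_complexPoints S
  haveI := hd
  haveI := pathConnectedSpace_complexPoints_of_smoothOfRelativeDimension S d
  have hU := isCohomologicallyLocallyTrivialOn_univ_of_isSmoothProjectiveFamily f d hf hS
  obtain ⟨s₀⟩ := (inferInstance : Nonempty (ComplexPoints S))
  obtain ⟨β, hβ⟩ := hD 𝒳 S f n hf hS hsm k σ hσ hpt s₀
  exact ⟨β, Theorems.HeckePrymWeilLine.gcs_section_eq_of_eq f k hU hσ hpt (continuous_globalSection f k β)
    (fun _ => rfl) hβ⟩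

/-- **Quasi-projective bases, arbitrary total space**: granted the proper-smooth partie fixe, `VHC` (item
stmt-HodgeConjecture-1076) gives the flat-section transport for EVERY smooth projective family (total space arbitrary)
over a smooth irreducible quasi-projective base — part XXVII's `flatSectionsAlgebraicQP_of_variationalHodgeQP` with the
fact in place of the quasi-projectivity of `𝒳`: the flat section is the section of one global class `β`, which is
fibrewise rational `(p,p)` and algebraic at the anchor, so `VHC` transports.
[cite: DeligneHodgeII1971, Théorème 4.1.1 (i)] [cite: CharlesSchnell2014Notes, proof of Prop. 11.3.5] -/
theorem flatSection_algebraic_of_deligne1971_of_vhc_of_isQuasiProjectiveOver_base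
    (hD : Literature.AlgebraicGeometry.HodgeTheory.deligne1971_invariantClass_fromTotalSpace_proper) (hV : Theses.AnchorTransport.VariationalHodge)
    ⦃n : ℕ⦄ ⦃𝒳 S : SchemeOver ℂ⦄ (f : 𝒳 ⟶ S) (hf : IsSmoothProjectiveFamily f n) (hS : IsQuasiProjectiveOver S)
    (hirr : IrreducibleSpace S.left) (hsm : AlgebraicGeometry.Smooth S.hom)
    (p : ℕ) (σ : ComplexPoints S → FiberClass f (2 * p)) (hσ : Continuous σ) (hpt : ∀ s, (σ s).pt = s)
    (hH : ∀ s, σ s ∈ locusOfHodgeClasses f n p)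
    (h₀ : ∃ s₀, (σ s₀).cls ∈ algebraicClasses (fiberOver f (σ s₀).pt) p) (s : ComplexPoints S) :
    (σ s).cls ∈ algebraicClasses (fiberOver f (σ s).pt) p := by
  obtain ⟨s₀, hs₀⟩ := h₀
  obtain ⟨β, hσβ⟩ := exists_globalSection_eq_of_flatSection_of_deligne1971 hD f hf hS hirr hsm (2 * p) hσ hpt
  have hA : ∀ t : ComplexPoints S, IsRationalClass (complexBetti.map (fiberι f t) (2 * p) β) ∧
      IsOfHodgeType n (fiberOver f t) (2 * p) p p (complexBetti.map (fiberι f t) (2 * p) β) := fun t =>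
    fiberClass_transfer_of_eq_mk (hσβ t)
      (fun t c => IsRationalClass c ∧ IsOfHodgeType n (fiberOver f t) (2 * p) p p c)
      ((mem_locusOfHodgeClasses_iff _).1 (hH t))
  have hβ₀ : complexBetti.map (fiberι f s₀) (2 * p) β ∈ algebraicClasses (fiberOver f s₀) p :=
    fiberClass_transfer_of_eq_mk (hσβ s₀) (fun t c => c ∈ algebraicClasses (fiberOver f t) p) hs₀
  exact fiberClass_transfer_to_eq_mk (hσβ s) (fun t c => c ∈ algebraicClasses (fiberOver f t) p)
    (hV f hf hirr hsm p β hA ⟨s₀, hβ₀⟩ s)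

/-- **R2. `VHC ∧ (Deligne, Hodge II, Thm. 4.1.1 (i)) ⟹ FlatSectionsAlgebraic` over ALL smooth irreducible bases** —
the b04-residual of BINDER-OWNERS (LEAD L38.4 (b)): reduction to affine bases (`flatSectionsAlgebraic_of_affine`; an
affine `ℂ`-scheme of finite type is quasi-projective, `IsQuasiProjectiveOver.of_isAffine`) and the quasi-projective-base
case above. `HC_CM` plays no role; no case of the Hodge conjecture is proved (an implication between typed inputs).
[cite: DeligneHodgeII1971, Théorème 4.1.1 (i)] [cite: CharlesSchnell2014Notes, Conj. 11.3.1, Thm. 11.3.4 and Prop. 11.3.5] -/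
theorem flatSectionsAlgebraic_of_deligne1971_of_vhc (hD : Literature.AlgebraicGeometry.HodgeTheory.deligne1971_invariantClass_fromTotalSpace_proper)
    (hV : Theses.AnchorTransport.VariationalHodge) : FlatSectionsAlgebraic :=
  flatSectionsAlgebraic_of_affine fun _ _ S f hf hirr haff hsm p σ hσ hpt hH h₀ s => by
    haveI := haff
    haveI := hsm
    haveI : LocallyOfFiniteType S.hom := inferInstance
    exact flatSection_algebraic_of_deligne1971_of_vhc_of_isQuasiProjectiveOver_base hD hV f hf
      (IsQuasiProjectiveOver.of_isAffine S) hirr hsm p σ hσ hpt hH h₀ s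

/-- **Modulo the proper-smooth partie fixe, the flat-section node and the global-class node are ONE node in the typed
generality: `FlatSectionsAlgebraic ↔ VHC`** (item 1076; with part I's `vhc_of_flatSectionsAlgebraic`). In print
(quasi-projective carriers) this is Charles–Schnell's use of the global invariant cycle theorem, kernel theorem
`flatSectionsAlgebraicQP_iff_variationalHodgeQP` of part XXVII; the typed nodes add non-quasi-projective total spaces and
bases, and exactly the former costs the fact. [cite: DeligneHodgeII1971, Théorème 4.1.1 (i)]
[cite: CharlesSchnell2014Notes, Conj. 11.3.1 and Prop. 11.3.5] -/
theorem flatSectionsAlgebraic_iff_vhc_of_deligne1971 (hD : Literature.AlgebraicGeometry.HodgeTheory.deligne1971_invariantClass_fromTotalSpace_proper) :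
    FlatSectionsAlgebraic ↔ Theses.AnchorTransport.VariationalHodge :=
  ⟨vhc_of_flatSectionsAlgebraic, flatSectionsAlgebraic_of_deligne1971_of_vhc hD⟩


/-! ## Audit: one NAMED FACT (`deligne1971_invariantClass_fromTotalSpace_proper`, a HYPOTHESIS everywhere), no `sorry`;
`HC_CM` does not occur; standard axioms only. -/

#print axioms Summit.HodgeConjecture.HodgeConjecture.Ring2.Hypotheses.flatSectionsAlgebraic_of_deligne1971_of_vhc
#print axioms Summit.HodgeConjecture.HodgeConjecture.Ring2.Hypotheses.flatSectionsAlgebraic_iff_vhc_of_deligne1971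

end Summit.HodgeConjecture.HodgeConjecture.Ring2.Hypotheses

end
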